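import Mathlib

/-!
# Route RigidityForcesSymmetry — `GrenetFirstOrderRankRigid` (item stmt-ValiantsHypothesis-21029),
line `grenet_gauge`: stub `stub_linearRigid`, step 5 (block II) — the linear algebra of an overlap block

For the crux line `Cruxes/GrenetFirstOrderRankRigid/Lines/grenet_gauge.lean` (blueprint
`Lines/grenet_gauge-stub_linearRigid-PROOF.md`, §5, block II; NOTES "TYPE II FORMAL PLAN").
Pure algebra: from the design identities E1 (for every core `C₀`), E2 and E3 of an overlap block with
at least two cores, over an integral domain of characteristic zero, every head entry is minus every
tail entry of the same core: `κ[T, p'] + ρ[T, p] = 0` (`blockII_filterAlgebra`).  Here `ρ κ : core → label → k`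
are the tail/head unknowns, `Tρ p = Σ_{C'} ρ[C', p]`, `Tκ p = Σ_{C'} κ[C', p]`, `A` is the set of block
letters and `Tset` the set of letters of the core `T`.  No new definitions.  VP ≠ VNP is not moved.
-/

open Finset

namespace Summit.ValiantsHypothesis.Theorems.RigidityForcesSymmetry.GrenetGauge

/-- **Step A of the block algebra.**  If `(Tρ αl - ρ C₀ αl) + (Tκ αf - κ C₀ αf) = 0` for every core
`C₀` (design E1) and there are at least two cores, then `Tρ αl + Tκ αf = 0` and
`ρ C₀ αl + κ C₀ αf = 0` for every core (characteristic zero). [folklore] -/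
theorem blockII_filterAlgebra_E1 {k : Type*} [CommRing k] [IsDomain k] [CharZero k] {β γ : Type*}
    (𝒞 : Finset β) (h𝒞 : 2 ≤ 𝒞.card) (ρ κ : β → γ → k) (Tρ Tκ : γ → k)
    (hTρ : ∀ p, Tρ p = ∑ C' ∈ 𝒞, ρ C' p) (hTκ : ∀ p, Tκ p = ∑ C' ∈ 𝒞, κ C' p) (αf αl : γ)
    (E1 : ∀ C₀ ∈ 𝒞, (Tρ αl - ρ C₀ αl) + (Tκ αf - κ C₀ αf) = 0) :
    Tρ αl + Tκ αf = 0 ∧ ∀ C₀ ∈ 𝒞, ρ C₀ αl + κ C₀ αf = 0 := by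
  have hG : ∀ C₀ ∈ 𝒞, ρ C₀ αl + κ C₀ αf = Tρ αl + Tκ αf := fun C₀ h => by
    linear_combination -(E1 C₀ h)
  have hsum : Tρ αl + Tκ αf = (𝒞.card : k) * (Tρ αl + Tκ αf) := by
    calc Tρ αl + Tκ αf = ∑ C' ∈ 𝒞, ρ C' αl + ∑ C' ∈ 𝒞, κ C' αf := by rw [hTρ, hTκ]
      _ = ∑ C' ∈ 𝒞, (ρ C' αl + κ C' αf) := Finset.sum_add_distrib.symm
      _ = ∑ C' ∈ 𝒞, (Tρ αl + Tκ αf) := Finset.sum_congr rfl hG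
      _ = (𝒞.card : k) * (Tρ αl + Tκ αf) := by rw [Finset.sum_const, nsmul_eq_mul]
  have hne : ((𝒞.card : k) - 1) ≠ 0 := by
    have : ((𝒞.card : k) - 1) = ((𝒞.card - 1 : ℕ) : k) := by
      rw [Nat.cast_sub (by omega), Nat.cast_one]
    rw [this, Nat.cast_ne_zero]; omega
  have hG0 : Tρ αl + Tκ αf = 0 := by
    have h : ((𝒞.card : k) - 1) * (Tρ αl + Tκ αf) = 0 := by linear_combination -hsum
    exact (mul_eq_zero.mp h).resolve_left hne
  exact ⟨hG0, fun C₀ h => by rw [hG C₀ h, hG0]⟩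

/-- **The linear algebra of an overlap block** (blueprint §5, type II).  From E1 (all cores, all
admissible letter pairs), E2 and E3 at the core `T`, with `|𝒞| ≥ 2`, `A ≠ ∅`, `Tset ≠ ∅`:
`κ[T, p'] + ρ[T, p] = 0` for every `p ∈ A ∪ Tset` and `p' ∉ Tset`. [folklore] -/
theorem blockII_filterAlgebra {k : Type*} [CommRing k] [IsDomain k] [CharZero k] {β γ : Type*} [DecidableEq γ]
    (𝒞 : Finset β) (T : β) (hT : T ∈ 𝒞) (h𝒞 : 2 ≤ 𝒞.card) (A Tset : Finset γ) (hA : A.Nonempty)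
    (hTne : Tset.Nonempty) (ρ κ : β → γ → k) (Tρ Tκ : γ → k)
    (hTρ : ∀ p, Tρ p = ∑ C' ∈ 𝒞, ρ C' p) (hTκ : ∀ p, Tκ p = ∑ C' ∈ 𝒞, κ C' p)
    (E1 : ∀ C₀ ∈ 𝒞, ∀ αf ∈ A, ∀ αl ∈ A, (αf ≠ αl ∨ A.card = 1) →
      (Tρ αl - ρ C₀ αl) + (Tκ αf - κ C₀ αf) = 0)
    (E2 : ∀ φ ∈ Tset, ∀ αₐ ∈ A, ∃ α₁ ∈ A, (α₁ ≠ αₐ ∨ A.card = 1) ∧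
      (Tρ αₐ - ρ T φ) + (Tκ α₁ - κ T α₁) = 0)
    (E3 : ∀ φ', φ' ∉ A → φ' ∉ Tset → ∀ α₁ ∈ A, ∃ αₐ ∈ A, (α₁ ≠ αₐ ∨ A.card = 1) ∧
      (Tρ αₐ - ρ T αₐ) + (Tκ α₁ - κ T φ') = 0)
    (p : γ) (hp : p ∈ A ∨ p ∈ Tset) (p' : γ) (hp' : p' ∉ Tset) :
    κ T p' + ρ T p = 0 := by
  -- Step A
  have stepA : ∀ αf ∈ A, ∀ αl ∈ A, (αf ≠ αl ∨ A.card = 1) →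
      Tρ αl + Tκ αf = 0 ∧ ∀ C₀ ∈ 𝒞, ρ C₀ αl + κ C₀ αf = 0 := fun αf hαf αl hαl hadm =>
    blockII_filterAlgebra_E1 𝒞 h𝒞 ρ κ Tρ Tκ hTρ hTκ αf αl (fun C₀ h => E1 C₀ h αf hαf αl hαl hadm)
  -- Step B: tail entries with a label in the core
  have stepB : ∀ φ ∈ Tset, ∀ αₐ ∈ A, ρ T φ = ρ T αₐ := by
    intro φ hφ αₐ hαₐ
    obtain ⟨α₁, hα₁, hadm, hE⟩ := E2 φ hφ αₐ hαₐ
    obtain ⟨G0, g⟩ := stepA α₁ hα₁ αₐ hαₐ hadm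
    linear_combination G0 - hE - g T hT
  -- Step C: head entries with a label outside the block
  have stepC : ∀ φ', φ' ∉ A → φ' ∉ Tset → ∀ α₁ ∈ A, κ T φ' = κ T α₁ := by
    intro φ' h1 h2 α₁ hα₁
    obtain ⟨αₐ, hαₐ, hadm, hE⟩ := E3 φ' h1 h2 α₁ hα₁
    obtain ⟨G0, g⟩ := stepA α₁ hα₁ αₐ hαₐ hadm
    linear_combination G0 - hE - g T hT
  -- Step D
  rcases Nat.lt_or_ge 1 A.card with h2 | h1
  · by_cases hpT : p ∈ Tset
    · -- reduce `p'` to a block letter `β`, then `p` to a block letter `α ≠ β`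
      obtain ⟨β, hβ, hκ⟩ : ∃ β ∈ A, κ T p' = κ T β := by
        by_cases hp'A : p' ∈ A
        · exact ⟨p', hp'A, rfl⟩
        · obtain ⟨β, hβ⟩ := hA
          exact ⟨β, hβ, stepC p' hp'A hp' β hβ⟩
      obtain ⟨α, hα, hαβ⟩ := Finset.exists_mem_ne h2 β
      rw [hκ, stepB p hpT α hα, add_comm]
      exact (stepA β hβ α hα (Or.inl hαβ.symm)).2 T hT
    · have hpA : p ∈ A := hp.resolve_right hpT
      by_cases hp'A : p' ∈ A
      · by_cases hpp : p' = p
        · obtain ⟨φ, hφ⟩ := hTne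
          obtain ⟨α', hα', hne'⟩ := Finset.exists_mem_ne h2 p
          have hρ : ρ T p = ρ T α' := by rw [← stepB φ hφ p hpA, stepB φ hφ α' hα']
          rw [hρ, hpp, add_comm]
          exact (stepA p hpA α' hα' (Or.inl hne'.symm)).2 T hT
        · rw [add_comm]
          exact (stepA p' hp'A p hpA (Or.inl hpp)).2 T hT
      · obtain ⟨β, hβ, hneβ⟩ := Finset.exists_mem_ne h2 p
        rw [stepC p' hp'A hp' β hβ, add_comm]
        exact (stepA β hβ p hpA (Or.inl hneβ)).2 T hT
  · -- `|A| = 1`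
    have hA1 : A.card = 1 := le_antisymm h1 (Finset.card_pos.mpr hA)
    obtain ⟨α₀, hA0⟩ := Finset.card_eq_one.mp hA1
    have hα₀ : α₀ ∈ A := by rw [hA0]; exact Finset.mem_singleton_self _
    have hρ : ρ T p = ρ T α₀ := by
      rcases hp with hpA | hpT
      · rw [hA0, Finset.mem_singleton] at hpA; rw [hpA]
      · exact stepB p hpT α₀ hα₀
    have hκ : κ T p' = κ T α₀ := by
      by_cases hp'A : p' ∈ A
      · rw [hA0, Finset.mem_singleton] at hp'A; rw [hp'A]
      · exact stepC p' hp'A hp' α₀ hα₀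
    rw [hρ, hκ, add_comm]
    exact (stepA α₀ hα₀ α₀ hα₀ (Or.inr hA1)).2 T hT

end Summit.ValiantsHypothesis.Theorems.RigidityForcesSymmetry.GrenetGauge
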